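import Literature.NumberTheory.Automorphic.SymPowOrdinaryLine
import Literature.NumberTheory.Automorphic.SymCoeffLattice
import HarnessLib

/-!
# The `U_p`-type coefficient sum `∑_x τ(N(x) t)` is nilpotent on `⨂_τ Sym^{k-2}((𝒪/ϖ^c)²)`

Topic `NumberTheory/Automorphic`; namespaces `Literature.NumberTheory.Automorphic.IntegralWeightGL2`
(one factor) and `Literature.NumberTheory.Automorphic.ParallelWeight` (the `𝒪`-form); theorems only
(no new definitions, no named fact, no `sorry`).

The coefficient-module input `hB` of the `H⁰`-nilpotency of `U_p` (`LevelControlDegreeZeroShift`)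
for the Bianchi coefficients `⨂_τ Sym^{k-2}`: for a finite family of integral elements `g_j`
(`j ∈ J`, `#J ≡ 0` modulo a nilpotent ideal `I` — the `q_v^r` unipotent representatives
`N(x) t_v^r` or their conjugates `N(x) t_v^r N(-x)`) whose local matrices at the embeddings `τ`
above the chosen place have vanishing `(1,0)`-entry, `(1,1)`-entry `1` and `(0,0)`-entry in `I`
(`= φ_τ(ϖ_v^r)`), and are the identity at the other embeddings,

* `IntegralWeightGL2.symPowAction_eq_coeff_smul_X1pow` — one factor: a matrix with vanishing
  first column contracts `Sym^m` onto the line of `A · X₁^m`, with `λ₁(A · X₁^m) = A₁₁^m`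
  (`SymPowOrdinaryLine`);
* `ParallelWeight.sum_tensorOp_mul_self` — over a ring in which those `(0,0)`-entries VANISH, the
  operator `B = ∑_j ⊗_τ Sym(M_{j,τ})` satisfies **`B ∘ B = #J · B`** (on pure tensors `B` multiplies
  by `Π_{τ above v} λ₁` and replaces those factors by the fixed vectors `M_{j,τ} X₁^m`, on which
  `λ₁ = 1`); hence `B² = 0` when `#J = 0`;
* `Module.End.pow_mul_eq_zero_of_range_pow_le` — `B^M V ⊆ I V` and `I^n V = 0` give `B^{Mn} = 0`;
* **`ParallelWeight.sum_symLatticeAction_pow_eq_zero`** — for the `𝒪'`-form (`𝒪'` any coefficient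
  ring, e.g. `𝒪/ϖ^c`, with `I^n · V = 0`, `#J ∈ I`): `(∑_j symLatticeAction(g_j))^{2n} = 0`, by
  reduction modulo `I` (`latticeQuotEquiv`, `latticeQuotEquiv_symLatticeAction`).
  [cite: Hida1994AIF, §3, proof of Thm 3.2] [cite: KhareThorne2017, §6.3–6.4]

## References

* H. Hida, Ann. Inst. Fourier 44 (1994), §2 (Prop. 2.1), §3. [Hida1994AIF]
* C. Khare, J. A. Thorne, Amer. J. Math. 139 (2017), §6.3–6.4. [KhareThorne2017]
-/

noncomputable section

open scoped TensorProduct NumberField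
open MvPolynomial PiTensorProduct IsDedekindDomain

namespace Literature.NumberTheory.Automorphic

/-! ### Generic: lifting nilpotency from `V/IV` -/

/-- **`B^M V ⊆ I V` and `I^n V = 0` imply `B^{M n} = 0`.** [folklore] -/
theorem Module.End.pow_mul_eq_zero_of_range_pow_le {R V : Type} [CommRing R] [AddCommGroup V]
    [Module R V] (I : Ideal R) (B : Module.End R V) {M n : ℕ}
    (hB : LinearMap.range (B ^ M) ≤ I • (⊤ : Submodule R V))
    (hI : I ^ n • (⊤ : Submodule R V) = ⊥) : B ^ (M * n) = 0 := by
  have key : ∀ k : ℕ, LinearMap.range (B ^ (M * k)) ≤ I ^ k • (⊤ : Submodule R V) := by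
    intro k
    induction k with
    | zero => simp
    | succ k ih =>
      rw [Nat.mul_succ, pow_add, Module.End.mul_eq_comp, LinearMap.range_comp]
      calc Submodule.map (B ^ (M * k)) (LinearMap.range (B ^ M))
          ≤ Submodule.map (B ^ (M * k)) (I • ⊤) := Submodule.map_mono hB
        _ = I • Submodule.map (B ^ (M * k)) ⊤ := Submodule.map_smul'' _ _ _
        _ ≤ I • (I ^ k • ⊤) := Submodule.smul_mono le_rfl (by rw [Submodule.map_top]; exact ih)
        _ = I ^ (k + 1) • ⊤ := by rw [← Submodule.mul_smul, pow_succ']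
  refine LinearMap.range_eq_bot.1 (le_bot_iff.1 ?_)
  calc LinearMap.range (B ^ (M * n)) ≤ I ^ n • ⊤ := key n
    _ = ⊥ := hI

/-- **`B^M V ⊆ I V` from the vanishing of `B̄^M` on a model `W` of `V/IV`**: `red : V → W` with
kernel inside `I V` intertwining `B` and `B̄`. [folklore] -/
theorem Module.End.range_pow_le_of_reduction {R V W : Type} [CommRing R] [AddCommGroup V]
    [Module R V] [AddCommGroup W] [Module R W] (I : Ideal R) (B : Module.End R V)
    (Bbar : Module.End R W) (red : V →ₗ[R] W) (hker : ∀ v, red v = 0 → v ∈ I • (⊤ : Submodule R V))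
    (hcomm : ∀ v, red (B v) = Bbar (red v)) {M : ℕ} (hM : Bbar ^ M = 0) :
    LinearMap.range (B ^ M) ≤ I • (⊤ : Submodule R V) := by
  have hpow : ∀ (m : ℕ) (v : V), red ((B ^ m) v) = (Bbar ^ m) (red v) := fun m => by
    induction m with
    | zero => intro v; rfl
    | succ m ih => intro v; rw [pow_succ', pow_succ', Module.End.mul_apply, Module.End.mul_apply,
        hcomm, ih]
  rintro _ ⟨v, rfl⟩
  exact hker _ (by rw [hpow, hM, LinearMap.zero_apply])

/-- `B ∘ B = c • B` gives `B^{n+1} = c^n • B`. [folklore] -/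
theorem Module.End.pow_succ_eq_smul_of_mul_self {R V : Type} [CommRing R] [AddCommGroup V]
    [Module R V] {B : Module.End R V} {c : R} (h : B * B = c • B) (n : ℕ) :
    B ^ (n + 1) = c ^ n • B := by
  induction n with
  | zero => rw [zero_add, pow_one, pow_zero, one_smul]
  | succ n ih => rw [pow_succ, ih, smul_mul_assoc, h, smul_smul, ← pow_succ]

namespace IntegralWeightGL2

open Literature.Computability.AlgebraicComplexity

variable {S : Type} [CommRing S]

/-- `X₁^m ∈ Sym^m`. [folklore] -/
theorem X_one_pow_mem (m : ℕ) : (X 1 ^ m : MvPolynomial (Fin 2) S) ∈ homogeneousSubmodule (Fin 2) S m :=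
  (mem_homogeneousSubmodule _ _).2 (isHomogeneous_X_pow 1 m)

/-- **One factor: `A · P = λ₁(P) · (A · X₁^m)` on `Sym^m` when the first column of `A` vanishes.**
[cite: Hida1994AIF, §2, proof of Prop. 2.1] -/
theorem symPowAction_eq_coeff_smul_X1pow {m : ℕ} {A : Matrix (Fin 2) (Fin 2) S} (h00 : A 0 0 = 0)
    (h10 : A 1 0 = 0) (P : SymPow S m) :
    symPowAction S m A P = coeff (Finsupp.single 1 m) (P : MvPolynomial (Fin 2) S) •
      symPowAction S m A ⟨X 1 ^ m, X_one_pow_mem m⟩ := by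
  refine Subtype.ext ?_
  rw [coe_symPowAction_eq_coeff_smul_of_col_zero h00 h10, Submodule.coe_smul, coe_symPowAction_apply]

/-- `λ₁(A · X₁^m) = A₁₁^m`. [folklore] -/
theorem coeff_symPowAction_X1pow {m : ℕ} {A : Matrix (Fin 2) (Fin 2) S} (h10 : A 1 0 = 0) :
    coeff (Finsupp.single 1 m)
      ((symPowAction S m A ⟨X 1 ^ m, X_one_pow_mem m⟩ : SymPow S m) : MvPolynomial (Fin 2) S) =
      A 1 1 ^ m := by
  rw [coe_symPowAction_apply]
  exact coeff_linSubst_X_one_pow h10 m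

end IntegralWeightGL2

namespace ParallelWeight

open IntegralWeightGL2

/-! ### The rank-one computation on pure tensors -/

section Tensor

variable {S : Type} [CommRing S] {ι : Type} [Fintype ι] {J : Type} [Fintype J]
  (m : ℕ) (T : Set ι) [DecidablePred (· ∈ T)] (M : J → ι → Matrix (Fin 2) (Fin 2) S)

/-- **`B ∘ B = #J · B`** for `B = ∑_j 𝔄_j`, `𝔄_j (⊗_i P_i) = ⊗_i (M_{j,i} · P_i)`, when the `M_{j,i}`,
`i ∈ T`, have vanishing first column and `(1,1)`-entry `1`, and `M_{j,i} = 1` for `i ∉ T`.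
[cite: Hida1994AIF, §3, proof of Thm 3.2] -/
theorem sum_tensorOp_mul_self (𝔄 : J → Module.End S (⨂[S] _i : ι, SymPow S m))
    (h𝔄 : ∀ (j : J) (P : ι → SymPow S m),
      𝔄 j (tprod S P) = tprod S fun i => symPowAction S m (M j i) (P i))
    (h00 : ∀ j i, i ∈ T → M j i 0 0 = 0) (h10 : ∀ j i, i ∈ T → M j i 1 0 = 0)
    (h11 : ∀ j i, i ∈ T → M j i 1 1 = 1) (hout : ∀ j i, i ∉ T → M j i = 1) :
    (∑ j, 𝔄 j) * (∑ j, 𝔄 j) = (Fintype.card J : S) • ∑ j, 𝔄 j := by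
  classical
  -- the scalar `c(P) = Π_{i ∈ T} λ₁(P_i)` and the vectors `Q_j(P)`
  set c : (ι → SymPow S m) → S := fun P =>
    ∏ i, (if i ∈ T then coeff (Finsupp.single 1 m) (P i : MvPolynomial (Fin 2) S) else 1) with hc
  set Q : J → (ι → SymPow S m) → (ι → SymPow S m) := fun j P i =>
    if i ∈ T then symPowAction S m (M j i) ⟨X 1 ^ m, X_one_pow_mem m⟩ else P i with hQ
  have hA : ∀ (j : J) (P : ι → SymPow S m), 𝔄 j (tprod S P) = c P • tprod S (Q j P) := by
    intro j P
    rw [h𝔄, hc, ← MultilinearMap.map_smul_univ]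
    congr 1
    funext i
    by_cases hi : i ∈ T
    · simp only [hQ, if_pos hi]
      exact symPowAction_eq_coeff_smul_X1pow (h00 j i hi) (h10 j i hi) (P i)
    · simp only [hQ, if_neg hi, one_smul, hout j i hi, map_one, Module.End.one_apply]
  have hcQ : ∀ (j : J) (P : ι → SymPow S m), c (Q j P) = 1 := by
    intro j P
    rw [hc]
    refine Finset.prod_eq_one fun i _ => ?_
    by_cases hi : i ∈ T
    · simp only [if_pos hi, hQ]
      rw [coeff_symPowAction_X1pow (h10 j i hi), h11 j i hi, one_pow]
    · rw [if_neg hi]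
  have hQQ : ∀ (j j' : J) (P : ι → SymPow S m), Q j' (Q j P) = Q j' P := by
    intro j j' P
    funext i
    by_cases hi : i ∈ T
    · simp only [hQ, if_pos hi]
    · simp only [hQ, if_neg hi]
  have hB : ∀ P : ι → SymPow S m, (∑ j, 𝔄 j) (tprod S P) = c P • ∑ j, tprod S (Q j P) := by
    intro P
    rw [LinearMap.sum_apply, Finset.smul_sum]
    exact Finset.sum_congr rfl fun j _ => hA j P
  refine PiTensorProduct.ext (MultilinearMap.ext fun P => ?_)
  rw [LinearMap.compMultilinearMap_apply, LinearMap.compMultilinearMap_apply, Module.End.mul_apply,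
    LinearMap.smul_apply, hB, map_smul, map_sum]
  simp_rw [hB, hcQ, one_smul, hQQ]
  rw [Finset.sum_const, Finset.card_univ, ← Nat.cast_smul_eq_nsmul S, smul_comm]

/-- Hence **`B ∘ B = 0` when `#J = 0` in `S`**, and `B² = 0`. [folklore] -/
theorem sum_tensorOp_sq_eq_zero (𝔄 : J → Module.End S (⨂[S] _i : ι, SymPow S m))
    (h𝔄 : ∀ (j : J) (P : ι → SymPow S m),
      𝔄 j (tprod S P) = tprod S fun i => symPowAction S m (M j i) (P i))
    (h00 : ∀ j i, i ∈ T → M j i 0 0 = 0) (h10 : ∀ j i, i ∈ T → M j i 1 0 = 0)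
    (h11 : ∀ j i, i ∈ T → M j i 1 1 = 1) (hout : ∀ j i, i ∉ T → M j i = 1)
    (hJ : (Fintype.card J : S) = 0) : (∑ j, 𝔄 j) ^ 2 = 0 := by
  rw [pow_two, sum_tensorOp_mul_self m T M 𝔄 h𝔄 h00 h10 h11 hout, hJ, zero_smul]

end Tensor

/-! ### The `𝒪'`-form -/

variable (O : Type) [CommRing O] (E : Type) [Field E] [CharZero E] (F : Type) [Field F] [NumberField F]
  (k : ℕ) (v : (F →+* E) → HeightOneSpectrum (𝓞 F))
  (φO : ∀ τ : F →+* E, (v τ).adicCompletionIntegers F →+* O)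

/-- **`(∑_j symLatticeAction(g_j))^{2n} = 0` on `⨂_τ Sym^{k-2}(𝒪'²)`** when `I^n · (⨂ …) = 0`,
`#J ∈ I`, and the local matrices of the `g_j` have, at the embeddings `τ ∈ T`, vanishing
`(1,0)`-entry, `(1,1)`-entry `1`, `(0,0)`-entry in `I`, and are `1` at `τ ∉ T` (the unipotent
representatives `N(x) t_v^r`, `T = {τ above v}`). [cite: Hida1994AIF, §3, proof of Thm 3.2]
[cite: KhareThorne2017, §6.3–6.4] -/
theorem sum_symLatticeAction_pow_eq_zero (I : Ideal O) {n : ℕ}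
    (hI : I ^ n • (⊤ : Submodule O (SymCoeffLattice O E F k)) = ⊥)
    {J : Type} [Fintype J] (hJ : (Fintype.card J : O) ∈ I) (g : J → integralMonoid F v)
    (T : Set (F →+* E)) [DecidablePred (· ∈ T)]
    (h00 : ∀ j τ, τ ∈ T → intMatrixAt O F v φO τ (g j) 0 0 ∈ I)
    (h10 : ∀ j τ, τ ∈ T → intMatrixAt O F v φO τ (g j) 1 0 = 0)
    (h11 : ∀ j τ, τ ∈ T → intMatrixAt O F v φO τ (g j) 1 1 = 1)
    (hout : ∀ j τ, τ ∉ T → intMatrixAt O F v φO τ (g j) = 1) :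
    (∑ j, symLatticeAction O E F k v φO (g j)) ^ (2 * n) = 0 := by
  classical
  set B : Module.End O (SymCoeffLattice O E F k) := ∑ j, symLatticeAction O E F k v φO (g j) with hB
  -- the reduction modulo `I`
  set φ' : ∀ τ : F →+* E, (v τ).adicCompletionIntegers F →+* O ⧸ I :=
    fun τ => (Ideal.Quotient.mk I).comp (φO τ) with hφ'
  set Bbar : Module.End (O ⧸ I) (SymCoeffLattice (O ⧸ I) E F k) :=
    ∑ j, symLatticeAction (O ⧸ I) E F k v φ' (g j) with hBbar
  have hBbar2 : Bbar ^ 2 = 0 := by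
    refine sum_tensorOp_sq_eq_zero (S := O ⧸ I) (k - 2) T (fun j τ => intMatrixAt (O ⧸ I) F v φ' τ (g j))
      (fun j => symLatticeAction (O ⧸ I) E F k v φ' (g j)) (fun j P => ?_) (fun j τ hτ => ?_)
      (fun j τ hτ => ?_) (fun j τ hτ => ?_) (fun j τ hτ => ?_) ?_
    · exact symLatticeAction_tprod (O ⧸ I) E F k v φ' (g j) P
    · rw [hφ', ← intMatrixAt_map, Matrix.map_apply, Ideal.Quotient.eq_zero_iff_mem]
      exact h00 j τ hτ
    · rw [hφ', ← intMatrixAt_map, Matrix.map_apply, h10 j τ hτ, map_zero]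
    · rw [hφ', ← intMatrixAt_map, Matrix.map_apply, h11 j τ hτ, map_one]
    · rw [hφ', ← intMatrixAt_map, hout j τ hτ, Matrix.map_one _ (map_zero _) (map_one _)]
    · rw [← map_natCast (Ideal.Quotient.mk I), Ideal.Quotient.eq_zero_iff_mem]
      exact hJ
  -- `Bbar` as an `O`-linear endomorphism, intertwined with `B` by the reduction map
  set red : SymCoeffLattice O E F k →ₗ[O] SymCoeffLattice (O ⧸ I) E F k :=
    (latticeQuotEquiv O E F k I).toLinearMap ∘ₗ (I • (⊤ : Submodule O (SymCoeffLattice O E F k))).mkQ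
    with hred
  have hker : ∀ x, red x = 0 → x ∈ I • (⊤ : Submodule O (SymCoeffLattice O E F k)) := by
    intro x hx
    rw [hred, LinearMap.comp_apply, LinearEquiv.coe_coe, LinearEquiv.map_eq_zero_iff,
      Submodule.mkQ_apply, Submodule.Quotient.mk_eq_zero] at hx
    exact hx
  have hcomm : ∀ x, red (B x) = (Bbar.restrictScalars O) (red x) := by
    intro x
    rw [LinearMap.restrictScalars_apply, hred, LinearMap.comp_apply, LinearMap.comp_apply,
      LinearEquiv.coe_coe, hB, hBbar, LinearMap.sum_apply, LinearMap.sum_apply, map_sum, map_sum]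
    refine Finset.sum_congr rfl fun j _ => ?_
    rw [← latticeQuotEquiv_symLatticeAction, Submodule.mkQ_apply, Submodule.mkQ_apply,
      Submodule.mapQ_apply]
  have hM : Bbar.restrictScalars O ^ 2 = 0 := by
    refine LinearMap.ext fun y => ?_
    have h := LinearMap.congr_fun hBbar2 y
    rw [pow_two, Module.End.mul_apply, LinearMap.zero_apply] at h ⊢
    rw [LinearMap.restrictScalars_apply, LinearMap.restrictScalars_apply]
    exact h
  exact Module.End.pow_mul_eq_zero_of_range_pow_le I B
    (Module.End.range_pow_le_of_reduction I B (Bbar.restrictScalars O) red hker hcomm hM) hI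

end ParallelWeight

end Literature.NumberTheory.Automorphic
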